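import Literature.MathematicalPhysics.QuantumLattice.HubbardFreeTorusGroundEnergy
import Summits.HubbardSuperconductivity.HubbardSuperconductivity.Theorems.ThermalWedgeTwTipContinuationEdgeOrderTorusTrig

/-!
# Half filling, part A: band counting on the torus (Template I) — crux `TwSeededEnsembleEquivalence` (stmt-HubbardSuperconductivity-1698)

Negative-side support lemmas (refuter, cdisprove gen 4), sorry-free and definition-free. Pure band/lattice facts
for the free dispersion `ε_L(k) = −2Σ_i cos(2πk_i/L)` on `(ℤ/Lℤ)²`, used by `HalfFilling.lean`:

* antiperiodicity `ε_L(k + (L/2,L/2)) = −ε_L(k)` for even `L` — REUSED from the tree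
  (`TwTipContinuation.IsogapTransport.torusBand_add_half`, not re-declared);
* `torusBand_mem_of_box`, `sq_le_card_filter_torusBand_small`, `sq_le_card_filter_abs_torusBand_le` — an
  explicit `(J+1) × (J+1)` box of momenta just above the quarter point `(π/2, π/2)` with
  `0 ≤ ε_L ≤ 8π(J+1)/L`, hence `#{k : |ε_L(k)| ≤ a} ≥ (aL/(16π))²` once `aL/(16π) ≥ 1` (`0 < a ≤ 2`);
* `legendre_pair_ge`, `free_legendre_defect_halfFilling_ge` — the pointwise bookkeeping
  `f(ε) + f(−ε) ≥ m·𝟙[|ε| ≤ m/2]`, `f(ε) = 2min(ε,0) − 2min(ε+m,0) + m`, and its sum over the zone: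
  `2Σ_k min(ε_k,0) − 2Σ_k min(ε_k + m,0) + mL² ≥ (m/2)·#{k : |ε_k| ≤ m/2}` (even `L`).
-/

namespace Summit.HubbardSuperconductivity.HubbardSuperconductivity.Theorems.TwSeededEnsembleEquivalence.Negative

open Literature.MathematicalPhysics.QuantumLattice Literature.Probability.LatticeModels

noncomputable section

/-! ### Band facts (the antiperiodicity `ε_L(k + (L/2,L/2)) = −ε_L(k)` for even `L` is the tree's
`Summit.HubbardSuperconductivity.TwTipContinuation.IsogapTransport.torusBand_add_half`, module
`Theorems/ThermalWedgeTwTipContinuationEdgeOrderTorusTrig`, imported above) -/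

section Band

variable {L : ℕ} [NeZero L]

/-! ### A box of momenta just above the Fermi level at half filling -/

/-- On the box `q ≤ k_i ≤ q + J` with `L ≤ 4q ≤ L + 3` and `8(J+1) ≤ L`, every angle `2πk_i/L` lies in
`[π/2, π/2 + 2π(J+1)/L] ⊂ [π/2, π]`, so `−2π(J+1)/L ≤ cos ≤ 0` and `0 ≤ ε_L(k) ≤ 8π(J+1)/L`. [folklore] -/
theorem torusBand_mem_of_box (q J : ℕ) (hq : L ≤ 4 * q) (hq' : 4 * q ≤ L + 3) (hJ : 8 * (J + 1) ≤ L)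
    (k : TorusSite 2 L) (hk : ∀ i : Fin 2, q ≤ (k i).val ∧ (k i).val ≤ q + J) :
    0 ≤ torusBand L k ∧ torusBand L k ≤ 8 * Real.pi * (J + 1) / L := by
  have hL0 : 0 < L := Nat.pos_of_ne_zero (NeZero.ne L)
  have hLr : (0 : ℝ) < L := by exact_mod_cast hL0
  set T : ℝ := 2 * Real.pi * (J + 1) / L with hT
  have hTpos : 0 ≤ T := by positivity
  have hTle : T ≤ Real.pi / 2 := by
    rw [hT, div_le_iff₀ hLr]
    have : (8 : ℝ) * (J + 1) ≤ L := by exact_mod_cast hJ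
    nlinarith [Real.pi_pos]
  -- each angle is in [π/2, π/2 + T]
  have hang : ∀ x : ℕ, q ≤ x → x ≤ q + J →
      Real.pi / 2 ≤ 2 * Real.pi * (x : ℝ) / L ∧ 2 * Real.pi * (x : ℝ) / L ≤ Real.pi / 2 + T := by
    intro x hx1 hx2
    have hx1r : (q : ℝ) ≤ x := by exact_mod_cast hx1
    have hx2r : (x : ℝ) ≤ q + J := by exact_mod_cast hx2
    have hqr : (L : ℝ) ≤ 4 * q := by exact_mod_cast hq
    have hqr' : 4 * (q : ℝ) ≤ L + 3 := by exact_mod_cast hq'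
    constructor
    · rw [le_div_iff₀ hLr]
      have h4 : 4 * (q : ℝ) ≤ 4 * x := by linarith
      nlinarith [mul_le_mul_of_nonneg_left (hqr.trans h4) (by positivity : (0 : ℝ) ≤ Real.pi / 2), Real.pi_pos]
    · have h : 2 * Real.pi * (x : ℝ) / L ≤ Real.pi / 2 + 2 * Real.pi * (J + 1) / L := by
        have e : Real.pi / 2 + 2 * Real.pi * (J + 1) / L = (Real.pi / 2 * L + 2 * Real.pi * (J + 1)) / L := by
          field_simp
        rw [e, div_le_div_iff_of_pos_right hLr]
        nlinarith [mul_le_mul_of_nonneg_left hx2r (by positivity : (0 : ℝ) ≤ 2 * Real.pi),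
          mul_le_mul_of_nonneg_left hqr' (by positivity : (0 : ℝ) ≤ Real.pi / 2), Real.pi_pos]
      rw [hT]; exact h
  have hcos : ∀ x : ℕ, q ≤ x → x ≤ q + J →
      -T ≤ Real.cos (2 * Real.pi * (x : ℝ) / L) ∧ Real.cos (2 * Real.pi * (x : ℝ) / L) ≤ 0 := by
    intro x hx1 hx2
    obtain ⟨ha1, ha2⟩ := hang x hx1 hx2
    constructor
    · have h1 : Real.cos (Real.pi / 2 + T) ≤ Real.cos (2 * Real.pi * (x : ℝ) / L) :=
        Real.cos_le_cos_of_nonneg_of_le_pi (by linarith [Real.pi_pos]) (by linarith) ha2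
      have h2 : Real.cos (Real.pi / 2 + T) = -Real.sin T := by
        rw [Real.cos_add, Real.cos_pi_div_two, Real.sin_pi_div_two]; ring
      have h3 : Real.sin T ≤ T := Real.sin_le hTpos
      linarith
    · have h1 : Real.cos (2 * Real.pi * (x : ℝ) / L) ≤ Real.cos (Real.pi / 2) :=
        Real.cos_le_cos_of_nonneg_of_le_pi (by linarith [Real.pi_pos]) (by linarith) ha1
      rwa [Real.cos_pi_div_two] at h1
  have hc0 := hcos (k 0).val (hk 0).1 (hk 0).2
  have hc1 := hcos (k 1).val (hk 1).1 (hk 1).2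
  have hband : torusBand L k =
      -2 * (Real.cos (2 * Real.pi * ((k 0).val : ℝ) / L) + Real.cos (2 * Real.pi * ((k 1).val : ℝ) / L)) := by
    simp only [torusBand, Fin.sum_univ_two, latticeMomentum_apply]
  rw [hband]
  constructor
  · nlinarith [hc0.2, hc1.2]
  · have : -2 * (Real.cos (2 * Real.pi * ((k 0).val : ℝ) / L) + Real.cos (2 * Real.pi * ((k 1).val : ℝ) / L)) ≤ 4 * T := by
      nlinarith [hc0.1, hc1.1]
    rw [hT] at this
    calc _ ≤ 4 * (2 * Real.pi * (J + 1) / L) := this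
      _ = 8 * Real.pi * (J + 1) / L := by ring

/-- **Box count**: with `L ≤ 4q ≤ L + 3` and `8(J+1) ≤ L`, at least `(J+1)²` momenta have
`0 ≤ ε_L(k) ≤ 8π(J+1)/L` (the box `(q + j₀, q + j₁)`, `j₀, j₁ ≤ J`). [folklore] -/
theorem sq_le_card_filter_torusBand_small (q J : ℕ) (hq : L ≤ 4 * q) (hq' : 4 * q ≤ L + 3)
    (hJ : 8 * (J + 1) ≤ L) :
    (J + 1) ^ 2 ≤ (Finset.univ.filter fun k : TorusSite 2 L =>
      0 ≤ torusBand L k ∧ torusBand L k ≤ 8 * Real.pi * (J + 1) / L).card := by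
  classical
  set F : ℕ × ℕ → TorusSite 2 L := fun p i => if i = 0 then ((q + p.1 : ℕ) : ZMod L) else ((q + p.2 : ℕ) : ZMod L)
    with hF
  have hF0 : ∀ p : ℕ × ℕ, q + p.1 < L → (F p 0).val = q + p.1 := fun p hp => by
    show ((q + p.1 : ℕ) : ZMod L).val = q + p.1
    rw [ZMod.val_natCast, Nat.mod_eq_of_lt hp]
  have hF1 : ∀ p : ℕ × ℕ, q + p.2 < L → (F p 1).val = q + p.2 := fun p hp => by
    show (if (1 : Fin 2) = 0 then ((q + p.1 : ℕ) : ZMod L) else ((q + p.2 : ℕ) : ZMod L)).val = q + p.2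
    rw [if_neg (by decide), ZMod.val_natCast, Nat.mod_eq_of_lt hp]
  set S := (Finset.range (J + 1)) ×ˢ (Finset.range (J + 1)) with hS
  have hinj : Set.InjOn F S := by
    intro p hp p' hp' heq
    simp only [hS, Finset.coe_product, Finset.coe_range, Set.mem_prod, Set.mem_Iio] at hp hp'
    have e0 := congrArg ZMod.val (congrFun heq 0)
    have e1 := congrArg ZMod.val (congrFun heq 1)
    rw [hF0 p (by omega), hF0 p' (by omega)] at e0
    rw [hF1 p (by omega), hF1 p' (by omega)] at e1
    exact Prod.ext (by omega) (by omega)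
  have hcard : (S.image F).card = (J + 1) ^ 2 := by
    rw [Finset.card_image_of_injOn hinj, hS, Finset.card_product, Finset.card_range, sq]
  rw [← hcard]
  refine Finset.card_le_card fun k hk => ?_
  rw [Finset.mem_image] at hk
  obtain ⟨p, hp, rfl⟩ := hk
  simp only [hS, Finset.mem_product, Finset.mem_range] at hp
  rw [Finset.mem_filter]
  refine ⟨Finset.mem_univ _, torusBand_mem_of_box q J hq hq' hJ (F p) fun i => ?_⟩
  fin_cases i
  · show q ≤ (F p 0).val ∧ (F p 0).val ≤ q + J
    rw [hF0 p (by omega)]; omega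
  · show q ≤ (F p 1).val ∧ (F p 1).val ≤ q + J
    rw [hF1 p (by omega)]; omega

/-- **Extensive count near the Fermi level**: for `0 < a ≤ 2` and `16π/a ≤ L`... precisely whenever
`1 ≤ aL/(16π)`: `#{k : |ε_L(k)| ≤ a} ≥ (aL/(16π))²`. [folklore] -/
theorem sq_le_card_filter_abs_torusBand_le {a : ℝ} (ha : 0 < a) (ha2 : a ≤ 2) (hL : 1 ≤ a * L / (16 * Real.pi)) :
    (a * L / (16 * Real.pi)) ^ 2 ≤
      ((Finset.univ.filter fun k : TorusSite 2 L => |torusBand L k| ≤ a).card : ℝ) := by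
  have hL0 : 0 < L := Nat.pos_of_ne_zero (NeZero.ne L)
  have hLr : (0 : ℝ) < L := by exact_mod_cast hL0
  have hπ := Real.pi_pos
  have hπ3 := Real.pi_gt_three
  set n : ℕ := ⌊a * L / (8 * Real.pi)⌋₊ with hn
  have hx0 : 0 ≤ a * L / (8 * Real.pi) := by positivity
  have hnle : (n : ℝ) ≤ a * L / (8 * Real.pi) := Nat.floor_le hx0
  have hnge : a * L / (8 * Real.pi) - 1 ≤ n := by
    have := Nat.lt_floor_add_one (a * L / (8 * Real.pi)); rw [← hn] at this; linarith
  have h2 : a * L / (8 * Real.pi) = 2 * (a * L / (16 * Real.pi)) := by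
    rw [mul_div_assoc' 2, div_eq_div_iff (by positivity) (by positivity)]; ring
  have hn1 : (1 : ℝ) ≤ n := by linarith
  have hn1' : 1 ≤ n := by exact_mod_cast hn1
  -- 8 n ≤ L (since a ≤ 2 < 8π... a L/(8π) ≤ L/(4π) < L/8)
  have h8n : 8 * n ≤ L := by
    have : 8 * (n : ℝ) ≤ L := by
      have : 8 * (a * L / (8 * Real.pi)) = a * L / Real.pi := by
        rw [mul_div_assoc' 8, div_eq_div_iff (by positivity) (by positivity)]; ring
      have h3 : a * L / Real.pi ≤ L := by
        rw [div_le_iff₀ hπ]; nlinarith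
      linarith
    exact_mod_cast this
  set q : ℕ := (L + 3) / 4 with hq
  have hq1 : L ≤ 4 * q := by omega
  have hq2 : 4 * q ≤ L + 3 := by omega
  have hJ : 8 * (n - 1 + 1) ≤ L := by rw [Nat.sub_add_cancel hn1']; exact h8n
  have hbox := sq_le_card_filter_torusBand_small q (n - 1) hq1 hq2 hJ
  rw [Nat.sub_add_cancel hn1'] at hbox
  -- the box levels satisfy |ε| ≤ 8π n/L ≤ a
  have hthr : 8 * Real.pi * ((n - 1 : ℕ) + 1 : ℝ) / L ≤ a := by
    have : ((n - 1 : ℕ) : ℝ) + 1 = n := by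
      rw [Nat.cast_sub hn1']; push_cast; ring
    rw [this, div_le_iff₀ hLr]
    have := mul_le_mul_of_nonneg_left hnle (by positivity : (0 : ℝ) ≤ 8 * Real.pi)
    have h4 : 8 * Real.pi * (a * L / (8 * Real.pi)) = a * L := by field_simp
    linarith
  have hsub : (Finset.univ.filter fun k : TorusSite 2 L =>
      0 ≤ torusBand L k ∧ torusBand L k ≤ 8 * Real.pi * ((n - 1 : ℕ) + 1) / L) ⊆
      (Finset.univ.filter fun k : TorusSite 2 L => |torusBand L k| ≤ a) := by
    intro k hk
    rw [Finset.mem_filter] at hk ⊢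
    refine ⟨hk.1, ?_⟩
    rw [abs_le]
    exact ⟨by linarith [hk.2.1], hk.2.2.trans hthr⟩
  have hcardle := Finset.card_le_card hsub
  have : ((n : ℝ)) ^ 2 ≤ ((Finset.univ.filter fun k : TorusSite 2 L => |torusBand L k| ≤ a).card : ℝ) := by
    have := hbox.trans hcardle
    exact_mod_cast this
  have hn2 : a * L / (16 * Real.pi) ≤ n := by linarith
  calc (a * L / (16 * Real.pi)) ^ 2 ≤ (n : ℝ) ^ 2 := pow_le_pow_left₀ (by positivity) hn2 2
    _ ≤ _ := this

/-! ### The pointwise Legendre bookkeeping at half filling -/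

/-- `f(ε) + f(−ε) ≥ m·𝟙[|ε| ≤ m/2]` for `f(ε) = 2min(ε,0) − 2min(ε+m,0) + m`, `m ≥ 0`. [folklore] -/
theorem legendre_pair_ge {m ε : ℝ} (hm : 0 ≤ m) :
    m * (if |ε| ≤ m / 2 then 1 else 0) ≤
      (2 * min ε 0 - 2 * min (ε + m) 0 + m) + (2 * min (-ε) 0 - 2 * min (-ε + m) 0 + m) := by
  split_ifs with h
  · rw [abs_le] at h
    rw [min_eq_right (by linarith : (0:ℝ) ≤ ε + m), min_eq_right (by linarith : (0:ℝ) ≤ -ε + m)]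
    rcases le_or_gt ε 0 with hε | hε
    · rw [min_eq_left hε, min_eq_right (by linarith : (0:ℝ) ≤ -ε)]; linarith
    · rw [min_eq_right hε.le, min_eq_left (by linarith : -ε ≤ 0)]; linarith
  · rw [mul_zero]
    rcases le_or_gt ε 0 with hε | hε
    · rw [min_eq_left hε, min_eq_right (by linarith : (0:ℝ) ≤ -ε), min_eq_right (by linarith : (0:ℝ) ≤ -ε + m)]
      rcases le_or_gt (ε + m) 0 with h1 | h1
      · rw [min_eq_left h1]; linarith
      · rw [min_eq_right h1.le]; linarith
    · rw [min_eq_right hε.le, min_eq_left (by linarith : -ε ≤ 0), min_eq_right (by linarith : (0:ℝ) ≤ ε + m)]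
      rcases le_or_gt (-ε + m) 0 with h1 | h1
      · rw [min_eq_left h1]; linarith
      · rw [min_eq_right h1.le]; linarith

/-- **The free Legendre defect at half filling is extensive**: for even `L`, `μ = −m < 0`,
`2Σ_k min(ε_k,0) − 2Σ_k min(ε_k + m, 0) + m L² ≥ (m/2)·#{k : |ε_k| ≤ m/2}`. [folklore] -/
theorem free_legendre_defect_halfFilling_ge (hL : Even L) {m : ℝ} (hm : 0 ≤ m) :
    m / 2 * ((Finset.univ.filter fun k : TorusSite 2 L => |torusBand L k| ≤ m / 2).card : ℝ) ≤
      2 * ∑ k : TorusSite 2 L, min (torusBand L k) 0 - 2 * ∑ k : TorusSite 2 L, min (torusBand L k + m) 0 +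
        m * (L : ℝ) ^ 2 := by
  set Q : TorusSite 2 L := fun _ => ((L / 2 : ℕ) : ZMod L) with hQ
  set f : ℝ → ℝ := fun ε => 2 * min ε 0 - 2 * min (ε + m) 0 + m with hf
  have hsumf : ∑ k : TorusSite 2 L, f (torusBand L k) =
      2 * ∑ k : TorusSite 2 L, min (torusBand L k) 0 - 2 * ∑ k : TorusSite 2 L, min (torusBand L k + m) 0 +
        m * (L : ℝ) ^ 2 := by
    simp only [hf, Finset.sum_add_distrib, Finset.sum_sub_distrib, ← Finset.mul_sum, Finset.sum_const,
      Finset.card_univ, card_torusSite_two, nsmul_eq_mul]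
    push_cast; ring
  have hperm : ∑ k : TorusSite 2 L, f (torusBand L (k + Q)) = ∑ k : TorusSite 2 L, f (torusBand L k) :=
    Fintype.sum_equiv (Equiv.addRight Q) _ _ (fun k => rfl)
  have hpair : ∀ k : TorusSite 2 L, m * (if |torusBand L k| ≤ m / 2 then 1 else 0) ≤
      f (torusBand L k) + f (torusBand L (k + Q)) := by
    intro k
    rw [Summit.HubbardSuperconductivity.TwTipContinuation.IsogapTransport.torusBand_add_half hL]
    exact legendre_pair_ge hm
  have hsum2 : m * ((Finset.univ.filter fun k : TorusSite 2 L => |torusBand L k| ≤ m / 2).card : ℝ) ≤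
      2 * ∑ k : TorusSite 2 L, f (torusBand L k) := by
    have h1 : ∑ k : TorusSite 2 L, m * (if |torusBand L k| ≤ m / 2 then (1 : ℝ) else 0) ≤
        ∑ k : TorusSite 2 L, (f (torusBand L k) + f (torusBand L (k + Q))) :=
      Finset.sum_le_sum fun k _ => hpair k
    rw [← Finset.mul_sum, Finset.sum_boole, Finset.sum_add_distrib, hperm] at h1
    push_cast at h1
    linarith
  rw [← hsumf]
  linarith

end Band

end

end Summit.HubbardSuperconductivity.HubbardSuperconductivity.Theorems.TwSeededEnsembleEquivalence.Negative
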